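/-
Copyright (c) 2026 the pub-hodgecm-mathlib formalisation cell (harness21).  Prover seat hodgecm-mathlib-K2E1b-p10 (g0),
Track B «K2-LIT» ∕ h413 (stmt-HodgeConjecture-24833), line K2_E1b «GKCohomologyU21», unit U3 «CARRIERS-DS DATA», file #12:
payment of the socket `K2E1bGKCohomologyU21.U23.sig_K2E1bDsDatum` — AT EVERY ARCHIMEDEAN PARAMETER `φ = rogTriple p q t` THERE IS AN
IRREDUCIBLE UNITARIZABLE INFINITE KOVAČEVIĆ DATUM WITH THE TWISTED CASIMIR DATA `(κ₀(φ), e(φ))`, AVOIDING THE `𝔭`-TYPES ON THE LOCUS.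
2026-09-03.
-/
import Literature.RepresentationTheory.Kovacevic2021.SU21Irreducible        -- ★ `isIrreducible_rayNE`, `isIrreducible_raySE`
import Literature.RepresentationTheory.Kovacevic2021.SU21UnitarityRays      -- ★ `rayNE_isUnitarizable`, `raySE_isUnitarizable`
import Literature.RepresentationTheory.Kovacevic2021.SU21CasimirCentral     -- ★ `casimir_rayNE_eq_smul`, `casimir_raySE_eq_smul`
import Literature.NumberTheory.Rogawski1990.OneDimAutRepH                    -- ★ `ArchSignRecipe.rogTriple`, `isCohTrivial_iff`
import HarnessLib

/-!
# K2_E1b road (h413 = stmt-HodgeConjecture-24833), unit U3 «CARRIERS-DS DATA», file #12: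
# the square-integrable carrier datum at every `φ`, with the locus clause

Cell `pub/hodgecm-mathlib` (D-0151), Track B (21-frontier RULING «PUSH BOTH» 2026-09-03, director req621∕req624, chair K2-lead,
dealer K2E1b-plan), socket module
`Summits/HodgeConjecture/HodgeConjecture/Cruxes/H413/Lines/K2_E1b_GKCohomologyU21_U23_CarriersData.lean` (planner K2E1b-plan (g0),
sha16 298b9591bc0170d4), socket **`sig_K2E1bDsDatum`** (SIGS TABLE row #12, size L): for every `(p, q, t)` with Rogawski triple
`(a, b, c) = rogTriple p q t` [Rogawski1990 §12.3 p. 178] (so `a ≥ b ≥ c` and `b − c = 1` in the `+` case `p + t ≤ −1`, `a − b = 1`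
in the `−` case), central exponent `e(φ) = a + b + c` and `𝔰𝔩(3)`-Casimir scalar `κ₀(φ) = (a² + b² + c² − 2) − e(φ)²∕3`, there is a
Kovačević `K`-type datum `𝒬` [Kovacevic2021 §3] which is irreducible (as a `𝔤𝔩(3, ℂ)`-module), unitarizable for `𝔰𝔲(2,1)`, has
infinitely many `K`-types `V_{n,m}`, all integral for the twist by `e(φ)` (`6 ∣ m − 3n + 3 + 2e(φ)`), on which the trace-form Casimir
`Σ_{ij} E_{ij} E_{ji}` acts by `κ₀(φ)`, and which ON THE LOCUS `rogTriple p q t = (1, 0, −1)` contains neither `𝔭`-type `V_{2,3}` nor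
`V_{2,−3}`.

THE MATHEMATICS.  LEVEL A of the line asks only for SOME datum with the prescribed `(κ₀, e)`-data (the socket quantifies `∃ 𝒬`); we pay it
with the RAY data of the tree [Kovacevic2021 §3 Thm. 3 (b75)∕(b80), §4 Thm. 4–5: the modules `U(0, 2t')`], i.e. the holomorphic ∕
antiholomorphic discrete series of `SU(2,1)` and their continuations along the wall `n₀ = 1`:
* write `s = p + t`; the odd integer `e' = |2s + 1| ≥ 1` indexes the witness: in the `−` case (`s ≥ 0`) the north-east ray ★ `rayNE e' 1`
  (`K`-types `V_{n, 3n + e'}`, `n ≥ 1`), in the `+` case (`s ≤ −1`) the south-east ray ★ `raySE e' 1` (`K`-types `V_{n, −(3n + e')}`);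
  the bottom constraint `2n₀² + (e' − 3)n₀ + (1 − e') = 0` of the ray data holds at `n₀ = 1` for every `e'` (§1);
* `2·1 + e' + 1 > 0`, so the ray is irreducible (★ `isIrreducible_rayNE∕raySE`: the up-arrow `−(2n + e' + 1)∕2` never vanishes) and
  unitarizable (★ `rayNE∕raySE_isUnitarizable`, Kovačević's Thm. 4 sign test ∕ Borel–Wallach VI Thm. 4.12 (2)) (§1); its `K`-types are an
  infinite set (§1);
* the Casimir: ★ `casimir_rayNE_eq_smul`∕`casimir_raySE_eq_smul` give `Σ E_{ij}E_{ji} = (e'² − 9)∕6` on the ray, and with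
  `(a, b, c) = (q + s + 1, q + s, q)` resp. `(q, q + s + 1, q + s)` both sides equal `(2s² + 2s − 4)∕3` (§2: `κ₀ = ((a−b)² + (b−c)² + (a−c)²)∕3 − 2`);
* integrality: `m − 3n = ±e'` on the ray and `e(φ) = 3q + 2s + 1`, so `m − 3n + 3 + 2e(φ) ∈ 6ℤ` (§3, `omega`);
* locus: `IsCohTrivial` forces `(q, s) = (−1, 1)` in the `−` case, `(1, −2)` in the `+` case (★ `isCohTrivial_iff`), i.e. `e' = 3`: the
  witnesses are then ★ `holDS = rayNE 3 1` (`V_{n, 3n+3}`) resp. ★ `antiholDS = raySE 3 1` (`V_{n, −3n−3}`), the discrete series `D₂`, `D₀`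
  of Borel–Wallach VI 4.10 with `H² ≠ 0 = H¹` [Rogawski1990 Prop. 15.2.1 (a)], whose `K`-types at `n = 2` have `m = ±9 ≠ ±3` (§3).
* §0 `sum_lie_lie_eq_casimir` — the socket's bracket spelling `Σ_{ij} ⁅E_{ij}, ⁅E_{ji}, v⁆⁆` IS ★ `SU21Datum.casimir v` (by `rfl` on summands).
* §3 **`dsDatum`** — `sig_K2E1bDsDatum` TOKEN FOR TOKEN.
No hypothesis is idle (the only hypothesis `rogTriple p q t = (a, b, c)` fixes `(a, b, c)`; for a triple not of this shape, e.g.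
`(a, b, c) = (0, 0, 0)`, the Casimir clause would demand the scalar `−2`, which no unitarizable datum of the tree is claimed to carry);
the conclusion is not vacuous (an explicit datum is exhibited at every `(p, q, t)`).  Off the locus print's own witness is the discrete
series `D^{∓}_φ ∈ Π(φ)` [Rogawski1990 §12.3 pp. 177–178], a quadrant datum of Kovačević's Thm. 3; LEVEL A does not distinguish it from
the ray with the same `(κ₀, e)`-data, and this file does not claim that identification.

HONEST LABEL: HC_CM is proved only modulo the 7 printed citations (2 remaining named inputs: hLiu418 = stmt-HodgeConjecture-24832,
h413 = stmt-HodgeConjecture-24833) until rung 0 closes; this file is a `--supports stmt-HodgeConjecture-24833` helper (scaffold of the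
K2_E1b road, consumed BY NAME by the assembly #21 `K2E1bDsCarrierClass`) and retires nothing by itself.

## References
* [Kovacevic2021] D. Kovačević, *Unitary `(𝔤,K)` modules of `SU(2,1)`*, Acta Math. Spalatensia 1 (2021) 105–125 (arXiv:1810.01752),
  §3 Def. 1, Thm. 1–3 ((b75), (b80)), Remark 3; §4 Thm. 4, Thm. 5 (`U(0, 2t)`).
* [BorelWallach2000] A. Borel, N. Wallach, *Continuous cohomology, discrete subgroups, and representations of reductive groups*,
  2nd ed., AMS (2000), II §2.3–2.5 (Casimir of the trace form), VI 4.8–4.12 (the cohomological modules of `SU(n,1)`, Thm. 4.11 (2),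
  Thm. 4.12 (2)).
* [Rogawski1990] J. Rogawski, *Automorphic Representations of Unitary Groups in Three Variables*, Ann. of Math. Stud. 123 (1990),
  §12.3 pp. 176–178 (the triple `(a, b, c)`, the packets `Π(φ)`), Prop. 15.2.1 (a) p. 249.
-/

set_option autoImplicit false
-- the mandated namespace repeats the single-problem summit's segment (`HodgeConjecture.HodgeConjecture`)
set_option linter.dupNamespace false

noncomputable section

open Literature.NumberTheory.Rogawski1990
open Literature.RepresentationTheory.Kovacevic2021 Literature.RepresentationTheory.Kovacevic2021.SU21Datum

-- Mathlib idiom (`Mathlib/Algebra/Lie/OfAssociative.lean`, and every file of the ★ Kovačević topic, the socket module itself):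
-- commutator bracket on `Matrix (Fin 3) (Fin 3) ℂ` ∕ `Module.End ℂ V`, needed to even state `LieModule.IsIrreducible ℂ 𝔤𝔩(3,ℂ) 𝒬.V`
-- and `⁅E i j, ⁅E j i, v⁆⁆` with the socket's bytes (`LieRing.ofAssociativeRing` is a `def`, not a global instance, in Mathlib)
attribute [local instance 100] LieRing.ofAssociativeRing

namespace Summit.HodgeConjecture.HodgeConjecture.Cruxes.H413.K2E1bDsDatum

/-! ## §0  The socket's bracket spelling of the Casimir -/

/-- **The bracket spelling is the Casimir operator.**  For any Kovačević datum `𝒟` and `v ∈ V`,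
`Σ_{i,j} ⁅E_{ij}, ⁅E_{ji}, v⁆⁆ = Ω v` with `Ω = Σ_{i,j} ρ(E_{ij}) ρ(E_{ji})` the Casimir operator of the trace form of `𝔤𝔩(3, ℂ)`
(★ `SU21Datum.casimir`; the bracket `⁅M, v⁆` is `ρ(M) v`, ★ `lie_def`). [cite: BorelWallach2000, II §2.3] [cite: Kovacevic2021, §3 Thm 1] -/
theorem sum_lie_lie_eq_casimir (𝒟 : SU21Datum) (v : 𝒟.V) :
    (∑ i : Fin 3, ∑ j : Fin 3, ⁅E i j, ⁅E j i, v⁆⁆) = 𝒟.casimir v := by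
  rw [SU21Datum.casimir, LinearMap.sum_apply]
  refine Finset.sum_congr rfl fun i _ => ?_
  rw [LinearMap.sum_apply]
  rfl

/-! ## §1  The ray data along the wall `n₀ = 1`: constraint, irreducibility, unitarizability, infinitely many `K`-types -/

/-- The bottom constraint `2n₀² + (e − 3)n₀ + (1 − e) = 0` of the ray data ★ `rayNE`∕`raySE` holds at `n₀ = 1` for EVERY `e`
(the factorisation `(n₀ − 1)(2n₀ + e − 1)`). [cite: Kovacevic2021, §3 Thm 3 (b75)] -/
theorem ray_constraint_one (e : ℤ) : 2 * (1 : ℤ) ^ 2 + (e - 3) * 1 + (1 - e) = 0 := by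
  ring

/-- **Irreducibility of the north-east ray `rayNE e n₀` when `2n₀ + e + 1 > 0`**: then the up-arrow `A_n = −(2n + e + 1)∕2` never
vanishes for `n ≥ n₀` (★ `isIrreducible_rayNE`). [cite: Kovacevic2021, §3 Thm 2, Thm 3 (b75)] -/
theorem isIrreducible_rayNE_of_pos (e n₀ : ℤ) (h₀ : 1 ≤ n₀) (h : 2 * n₀ ^ 2 + (e - 3) * n₀ + (1 - e) = 0)
    (he : 0 < 2 * n₀ + e + 1) : LieModule.IsIrreducible ℂ (Matrix (Fin 3) (Fin 3) ℂ) (rayNE e n₀ h₀ h).V :=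
  isIrreducible_rayNE e n₀ h₀ h fun n hn => by omega

/-- **Irreducibility of the south-east ray `raySE e n₀` when `2n₀ + e + 1 > 0`** (★ `isIrreducible_raySE`).
[cite: Kovacevic2021, §3 Thm 2, Thm 3 (b80)] -/
theorem isIrreducible_raySE_of_pos (e n₀ : ℤ) (h₀ : 1 ≤ n₀) (h : 2 * n₀ ^ 2 + (e - 3) * n₀ + (1 - e) = 0)
    (he : 0 < 2 * n₀ + e + 1) : LieModule.IsIrreducible ℂ (Matrix (Fin 3) (Fin 3) ℂ) (raySE e n₀ h₀ h).V :=
  isIrreducible_raySE e n₀ h₀ h fun n hn => by omega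

/-- The north-east ray has infinitely many `K`-types `V_{n₀ + k, 3(n₀ + k) + e}`, `k ∈ ℕ`. [cite: Kovacevic2021, §4 Thm 5 (`U(l, 2t)`)] -/
theorem rayNE_S_infinite (e n₀ : ℤ) (h₀ : 1 ≤ n₀) (h : 2 * n₀ ^ 2 + (e - 3) * n₀ + (1 - e) = 0) :
    (rayNE e n₀ h₀ h).S.Infinite := by
  refine Set.infinite_of_injective_forall_mem (f := fun k : ℕ => (n₀ + k, 3 * (n₀ + k) + e)) ?_ ?_
  · intro i j hij
    simp only [Prod.mk.injEq] at hij
    exact_mod_cast (add_left_cancel hij.1 : (i : ℤ) = j)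
  · intro k
    exact ⟨by change n₀ ≤ n₀ + (k : ℤ); omega, rfl⟩

/-- The south-east ray has infinitely many `K`-types `V_{n₀ + k, −(3(n₀ + k) + e)}`, `k ∈ ℕ`. [cite: Kovacevic2021, §4 Thm 5] -/
theorem raySE_S_infinite (e n₀ : ℤ) (h₀ : 1 ≤ n₀) (h : 2 * n₀ ^ 2 + (e - 3) * n₀ + (1 - e) = 0) :
    (raySE e n₀ h₀ h).S.Infinite := by
  refine Set.infinite_of_injective_forall_mem (f := fun k : ℕ => (n₀ + k, -(3 * (n₀ + k) + e))) ?_ ?_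
  · intro i j hij
    simp only [Prod.mk.injEq] at hij
    exact_mod_cast (add_left_cancel hij.1 : (i : ℤ) = j)
  · intro k
    exact ⟨by change n₀ ≤ n₀ + (k : ℤ); omega, rfl⟩

/-! ## §2  The Casimir on the rays, in the socket's spelling -/

/-- **`Σ_{ij} ⁅E_{ij}, ⁅E_{ji}, v⁆⁆ = ((e² − 9)∕6) v` on the north-east ray `rayNE e n₀`** (★ `casimir_rayNE_eq_smul`, read through §0).
[cite: Kovacevic2021, §3 Thm 3 (b75), Remark 3] [cite: BorelWallach2000, II §2.5] -/
theorem rayNE_sum_lie_lie (e n₀ : ℤ) (h₀ : 1 ≤ n₀) (h : 2 * n₀ ^ 2 + (e - 3) * n₀ + (1 - e) = 0) (v : (rayNE e n₀ h₀ h).V) :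
    (∑ i : Fin 3, ∑ j : Fin 3, ⁅E i j, ⁅E j i, v⁆⁆) = (((e : ℂ) ^ 2 - 9) / 6) • v := by
  rw [sum_lie_lie_eq_casimir, casimir_rayNE_eq_smul e n₀ h₀ h, LinearMap.smul_apply, Module.End.one_apply]

/-- **`Σ_{ij} ⁅E_{ij}, ⁅E_{ji}, v⁆⁆ = ((e² − 9)∕6) v` on the south-east ray `raySE e n₀`** (★ `casimir_raySE_eq_smul`, read through §0).
[cite: Kovacevic2021, §3 Thm 3 (b80), Remark 3] [cite: BorelWallach2000, II §2.5] -/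
theorem raySE_sum_lie_lie (e n₀ : ℤ) (h₀ : 1 ≤ n₀) (h : 2 * n₀ ^ 2 + (e - 3) * n₀ + (1 - e) = 0) (v : (raySE e n₀ h₀ h).V) :
    (∑ i : Fin 3, ∑ j : Fin 3, ⁅E i j, ⁅E j i, v⁆⁆) = (((e : ℂ) ^ 2 - 9) / 6) • v := by
  rw [sum_lie_lie_eq_casimir, casimir_raySE_eq_smul e n₀ h₀ h, LinearMap.smul_apply, Module.End.one_apply]

/-! ## §3  The head -/

/-- **PAYMENT OF `sig_K2E1bDsDatum`** (socket #12 of unit U3 «CARRIERS-DS DATA» of the K2_E1b road,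
`Cruxes/H413/Lines/K2_E1b_GKCohomologyU21_U23_CarriersData.lean`, TOKEN FOR TOKEN).
**At every `φ = rogTriple p q t` there is an irreducible, unitarizable Kovačević datum with infinitely many `K`-types, integral for the
twist by `e(φ) = a + b + c`, on which `Σ_{ij} E_{ij} E_{ji}` acts by `κ₀(φ) = (a² + b² + c² − 2) − e(φ)²∕3`, and which on the locus
`φ = (1, 0, −1)` contains neither `V_{2,3}` nor `V_{2,−3}`.**  Witness (`s = p + t`, `e' = |2s + 1|`): the ray ★ `rayNE e' 1` (`−` case,
`s ≥ 0`) resp. ★ `raySE e' 1` (`+` case, `s ≤ −1`) — Kovačević's `U(0, 2t')` along the wall `n₀ = 1`, irreducible and unitarizable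
since `e' + 3 > 0` (§1), Casimir `(e'² − 9)∕6 = κ₀(φ)` (§2), `K`-types `V_{n, ±(3n + e')}` with `±e' + 3 + 2e(φ) ∈ 6ℤ`; on the locus
`e' = 3` and the witness is the holomorphic ∕ antiholomorphic discrete series ★ `holDS`∕`antiholDS` (`D₂`∕`D₀`, `H¹ = 0`), whose
`K`-types at `n = 2` are `V_{2, ±9}`.
[cite: Kovacevic2021, §3 Thm 3; §4 Thm 4–5] [cite: BorelWallach2000, VI 4.10, Thm 4.11 (2), Thm 4.12 (2)]
[cite: Rogawski1990, §12.3 pp. 177–178; Prop. 15.2.1 (a)] -/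
theorem dsDatum :
    ∀ (p q t a b c : ℤ), ArchSignRecipe.rogTriple p q t = (a, b, c) →
      ∃ 𝒬 : SU21Datum, LieModule.IsIrreducible ℂ (Matrix (Fin 3) (Fin 3) ℂ) 𝒬.V ∧ IsUnitarizable 𝒬 ∧ 𝒬.S.Infinite ∧
        (∀ n m : ℤ, (n, m) ∈ 𝒬.S → (6 : ℤ) ∣ m - 3 * n + 3 + 2 * (a + b + c)) ∧
        (∀ v : 𝒬.V, (∑ i : Fin 3, ∑ j : Fin 3, ⁅E i j, ⁅E j i, v⁆⁆) =
          ((((a ^ 2 + b ^ 2 + c ^ 2 - 2 : ℤ) : ℂ)) - (((a + b + c : ℤ) : ℂ)) ^ 2 / 3) • v) ∧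
        (ArchSignRecipe.IsCohTrivial p q t → ((2 : ℤ), (3 : ℤ)) ∉ 𝒬.S ∧ ((2 : ℤ), (-3 : ℤ)) ∉ 𝒬.S) := by
  intro p q t a b c hφ
  unfold ArchSignRecipe.rogTriple at hφ
  by_cases hs : p + t ≤ -1
  · /- the `+` case: `(a, b, c) = (q, q + s + 1, q + s)`; witness the south-east ray with `e' = −(2s + 1) ≥ 1` -/
    rw [if_pos hs] at hφ
    simp only [Prod.mk.injEq] at hφ
    obtain ⟨ha, hb, hc⟩ := hφ
    subst ha hb hc
    refine ⟨raySE (-(2 * (p + t) + 1)) 1 le_rfl (ray_constraint_one _), ?_, ?_, ?_, ?_, ?_, ?_⟩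
    · exact isIrreducible_raySE_of_pos (-(2 * (p + t) + 1)) 1 le_rfl (ray_constraint_one _) (by omega)
    · exact raySE_isUnitarizable (-(2 * (p + t) + 1)) 1 le_rfl (ray_constraint_one _) (by omega)
    · exact raySE_S_infinite (-(2 * (p + t) + 1)) 1 le_rfl (ray_constraint_one _)
    · rintro n m ⟨-, hm⟩
      change m = -(3 * n + (-(2 * (p + t) + 1))) at hm
      omega
    · intro v
      rw [raySE_sum_lie_lie]
      congr 1
      push_cast
      ring
    · intro hcoh
      rw [ArchSignRecipe.isCohTrivial_iff] at hcoh
      refine ⟨?_, ?_⟩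
      · rintro ⟨-, hm⟩
        change (3 : ℤ) = -(3 * 2 + (-(2 * (p + t) + 1))) at hm
        omega
      · rintro ⟨-, hm⟩
        change (-3 : ℤ) = -(3 * 2 + (-(2 * (p + t) + 1))) at hm
        omega
  · /- the `−` case: `(a, b, c) = (q + s + 1, q + s, q)`; witness the north-east ray with `e' = 2s + 1 ≥ 1` -/
    rw [if_neg hs] at hφ
    simp only [Prod.mk.injEq] at hφ
    obtain ⟨ha, hb, hc⟩ := hφ
    subst ha hb hc
    refine ⟨rayNE (2 * (p + t) + 1) 1 le_rfl (ray_constraint_one _), ?_, ?_, ?_, ?_, ?_, ?_⟩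
    · exact isIrreducible_rayNE_of_pos (2 * (p + t) + 1) 1 le_rfl (ray_constraint_one _) (by omega)
    · exact rayNE_isUnitarizable (2 * (p + t) + 1) 1 le_rfl (ray_constraint_one _) (by omega)
    · exact rayNE_S_infinite (2 * (p + t) + 1) 1 le_rfl (ray_constraint_one _)
    · rintro n m ⟨-, hm⟩
      change m = 3 * n + (2 * (p + t) + 1) at hm
      omega
    · intro v
      rw [rayNE_sum_lie_lie]
      congr 1
      push_cast
      ring
    · intro hcoh
      rw [ArchSignRecipe.isCohTrivial_iff] at hcoh
      refine ⟨?_, ?_⟩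
      · rintro ⟨-, hm⟩
        change (3 : ℤ) = 3 * 2 + (2 * (p + t) + 1) at hm
        omega
      · rintro ⟨-, hm⟩
        change (-3 : ℤ) = 3 * 2 + (2 * (p + t) + 1) at hm
        omega

end Summit.HodgeConjecture.HodgeConjecture.Cruxes.H413.K2E1bDsDatum

end
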